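/-
Copyright (c) 2026. All rights reserved.
Released under Apache 2.0 license as described in the file LICENSE.
Authors: abc-iut cell, seat abc-iut-L4-t15 (gen 6).
-/
import Literature.GroupTheory.PByMetacyclicChiefFactors

/-!
# The top layer of the hypercentral part of a quasi-minimal normal subgroup: `Z ≤ ⁅N, P⁆ ⊔ ⁅Z, G⁆`

Setting as in `Literature/GroupTheory/PByMetacyclicChiefFactors.lean`: `P ⊴ G` a normal `p`-subgroup,
`t, s ∈ G` with conjugates of `t` in `⟨t⟩P`, `t ^ e ∈ P` (`e` coprime to `p`), `G = ⟨P, t, s⟩`;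
`Z < N ≤ P` normal with `N = ⁅N, G⁆`, `N/Z` a chief factor of `G` and `⁅N, P⁆ ≤ Z`.  Writing
`D = ⁅N, P⁆ ⊔ ⁅Z, G⁆` (so `N/D` is abelian, `Z/D` central, `P` acts trivially on `N/D`), we prove
**`Z ≤ D`** in both cases of the dichotomy:

* `le_of_fpf_of_commutator_repr` — the common core: if `u` acts fixed-point-freely on `N/Z` and every
  commutator class `⁅n,g⁆D` is of the form `⁅a,u⁆D`, then `Z ≤ D` (the classes `⁅a,u⁆D` form a subgroup
  of `G/D` exhausting `N = ⁅N,G⁆`; one lying in `Z/D` is trivial by fixed-point-freeness twice);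
* `le_commutator_sup_of_fpf_t` — case `t` fixed-point-free: conjugates `g⁅a,t⁆g⁻¹ ≡ ⁅a', t^c⁆` are again
  such classes, and `N = {⁅a,t⁆}·Z` modulo `D`;
* `commutator_mem_sup_of_triv_t` — case `t` trivial on `N/Z`: then `⁅N, t⁆ ⊆ D` by coprimality
  (`t n t⁻¹ ≡ c n`, `n ≡ t^e n t^{-e} ≡ c^e n`, `c` of `p`-power order);
* `le_commutator_sup_of_triv_t` — case `t` trivial, `s` fixed-point-free: `{g | ⁅N,g⁆ ⊆ {⁅a,s⁆}·D}` is a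
  subgroup (`⁅n, gh⁆ = ⁅n,h⁆⁅hnh⁻¹,g⁆`) containing `P, t, s`.

Elementary replacement, for this class of groups, of the soluble case of the Nikolov–Segal Key Theorem
(Ann. of Math. 165 (2007), §7, which in general needs Segal's quadratic-map machinery).  Finite group
theory over Mathlib; no definitions, no instances (cell abc-iut, GAP-LEDGER G-L3d2g2-1).
-/

namespace Literature.GroupTheory

open scoped commutatorElement

variable {G : Type*} [Group G]

/-! ### The top layer of `Z`: `Z ≤ ⁅N, P⁆ ⊔ ⁅Z, G⁆` -/

/-- `⁅n, g h⁆ = ⁅n, h⁆ * ⁅h n h⁻¹, g⁆`. [folklore] -/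
private theorem commutatorElement_mul_right' (n g h : G) :
    ⁅n, g * h⁆ = ⁅n, h⁆ * ⁅h * n * h⁻¹, g⁆ := by
  simp only [commutatorElement_def]; group

/-- The classes `⁅a, u⁆ D` (`a ∈ N`) form a subgroup of `G ⧸ D` when `⁅N, N⁆ ≤ D`
(`⁅ba, u⁆ ≡ ⁅a,u⁆⁅b,u⁆`, `⁅a⁻¹,u⁆ ≡ ⁅a,u⁆⁻¹`). [folklore] -/
private theorem exists_subgroup_commutator_classes (N D : Subgroup G) [hN : N.Normal] [hD : D.Normal]
    (hNND : ⁅N, N⁆ ≤ D) (u : G) :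
    ∃ J : Subgroup (G ⧸ D), ∀ q : G ⧸ D, q ∈ J ↔ ∃ a ∈ N, q = QuotientGroup.mk' D ⁅a, u⁆ := by
  let mk := QuotientGroup.mk' D
  have hmemN : ∀ a ∈ N, ⁅a, u⁆ ∈ N := fun a ha => by
    rw [commutatorElement_def]
    have : a * u * a⁻¹ * u⁻¹ = a * (u * a⁻¹ * u⁻¹) := by group
    rw [this]; exact N.mul_mem ha (hN.conj_mem _ (N.inv_mem ha) u)
  -- conjugation by an element of `N` is trivial on `N` modulo `D`
  have hconj : ∀ b ∈ N, ∀ c ∈ N, mk (b * c * b⁻¹) = mk c := by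
    intro b hb c hc
    rw [QuotientGroup.mk'_apply, QuotientGroup.mk'_apply, QuotientGroup.eq]
    have : (b * c * b⁻¹)⁻¹ * c = ⁅b, c⁻¹⁆ := by simp only [commutatorElement_def]; group
    rw [this]; exact hNND (Subgroup.commutator_mem_commutator hb (N.inv_mem hc))
  refine ⟨{ carrier := {q | ∃ a ∈ N, q = mk ⁅a, u⁆}
            mul_mem' := ?_, one_mem' := ⟨1, N.one_mem, by simp⟩, inv_mem' := ?_ }, fun q => Iff.rfl⟩
  · rintro _ _ ⟨a, ha, rfl⟩ ⟨b, hb, rfl⟩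
    refine ⟨b * a, N.mul_mem hb ha, ?_⟩
    rw [commutatorElement_mul_left_eq_conj_mul, map_mul, hconj b hb _ (hmemN a ha)]
  · rintro _ ⟨a, ha, rfl⟩
    refine ⟨a⁻¹, N.inv_mem ha, ?_⟩
    rw [commutatorElement_inv_left, ← commutatorElement_inv, ← map_inv]
    have := hconj a⁻¹ (N.inv_mem ha) _ (N.inv_mem (hmemN a ha))
    simpa using this.symm

/-- **Core of the top-layer argument.** Let `Z ≤ N ≤ P` and `D ≤ Z` be normal subgroups with
`⁅N, P⁆ ≤ D`, `⁅Z, G⁆ ≤ D` and `⁅N, G⁆ = N`.  Suppose `u ∈ G` acts fixed-point-freely on `N/Z` and every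
commutator `⁅n, g⁆` (`n ∈ N`, `g ∈ G`) is congruent modulo `D` to some `⁅a, u⁆` (`a ∈ N`).  Then `Z ≤ D`:
the classes `⁅a,u⁆D` form a subgroup of `G/D` containing `⁅N,G⁆D = ND ⊇ Z`, and a class `⁅a,u⁆D ⊆ Z`
forces `a ∈ Z`, whence `⁅a,u⁆ ∈ ⁅Z,G⁆ ≤ D`. [cite: NikolovSegal2007, §7] -/
theorem le_of_fpf_of_commutator_repr (P N Z D : Subgroup G) [hN : N.Normal]
    [hD : D.Normal] (hNP : N ≤ P) (hZN : Z ≤ N) (hNPD : ⁅N, P⁆ ≤ D)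
    (hZGD : ⁅Z, (⊤ : Subgroup G)⁆ ≤ D) (hDZ : D ≤ Z) (hNG : ⁅N, (⊤ : Subgroup G)⁆ = N) (u : G)
    (hu : ∀ n ∈ N, ⁅n, u⁆ ∈ Z → n ∈ Z)
    (hrepr : ∀ n ∈ N, ∀ g : G, ∃ a ∈ N, ⁅n, g⁆⁻¹ * ⁅a, u⁆ ∈ D) : Z ≤ D := by
  have hNND : ⁅N, N⁆ ≤ D := (Subgroup.commutator_mono le_rfl hNP).trans hNPD
  let mk := QuotientGroup.mk' D
  obtain ⟨J, hJ⟩ := exists_subgroup_commutator_classes N D hNND u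
  -- every element of `⁅N, G⁆` has its class in `J`
  have hall : ∀ w ∈ ⁅N, (⊤ : Subgroup G)⁆, mk w ∈ J := by
    intro w hw
    rw [Subgroup.commutator_def] at hw
    induction hw using Subgroup.closure_induction with
    | mem x hx =>
      obtain ⟨n, hn, g, -, rfl⟩ := hx
      obtain ⟨a, ha, hna⟩ := hrepr n hn g
      exact (hJ _).mpr ⟨a, ha, by
        rw [QuotientGroup.mk'_apply, QuotientGroup.mk'_apply, QuotientGroup.eq]; exact hna⟩
    | one => rw [map_one]; exact J.one_mem
    | mul x y _ _ hx hy => rw [map_mul]; exact J.mul_mem hx hy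
    | inv x _ hx => rw [map_inv]; exact J.inv_mem hx
  intro z hz
  have hzN : z ∈ ⁅N, (⊤ : Subgroup G)⁆ := by rw [hNG]; exact hZN hz
  obtain ⟨a, ha, hza⟩ := (hJ _).mp (hall z hzN)
  have hza' : z⁻¹ * ⁅a, u⁆ ∈ D := by
    rw [QuotientGroup.mk'_apply, QuotientGroup.mk'_apply, QuotientGroup.eq] at hza; exact hza
  -- `⁅a, u⁆ ∈ Z`, hence `a ∈ Z`, hence `⁅a, u⁆ ∈ ⁅Z, G⁆ ≤ D`
  have hau : ⁅a, u⁆ ∈ Z := by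
    have : ⁅a, u⁆ = z * (z⁻¹ * ⁅a, u⁆) := by group
    rw [this]; exact Z.mul_mem hz (hDZ hza')
  have haZ : a ∈ Z := hu a ha hau
  have hauD : ⁅a, u⁆ ∈ D := hZGD (Subgroup.commutator_mem_commutator haZ (Subgroup.mem_top u))
  have : z = ⁅a, u⁆ * (z⁻¹ * ⁅a, u⁆)⁻¹ := by group
  rw [this]
  exact D.mul_mem hauD (D.inv_mem hza')

/-- **Top layer of `Z`, case `t` fixed-point-free.** In the setting of the module docstring, if `t`
acts fixed-point-freely on the chief factor `N/Z` then `Z ≤ ⁅N, P⁆ ⊔ ⁅Z, G⁆`.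
[cite: NikolovSegal2007, §7] -/
theorem le_commutator_sup_of_fpf_t [Finite G] (P N Z : Subgroup G) [hP : P.Normal] [hN : N.Normal]
    [hZ : Z.Normal] (t : G) (hNP : N ≤ P) (hZN : Z ≤ N) (hNPZ : ⁅N, P⁆ ≤ Z)
    (hNG : ⁅N, (⊤ : Subgroup G)⁆ = N)
    (ht_conj : ∀ g : G, ∃ a : ℕ, ∃ y ∈ P, g * t * g⁻¹ = t ^ a * y)
    (ht_fpf : ∀ n ∈ N, ⁅n, t⁆ ∈ Z → n ∈ Z) :
    Z ≤ ⁅N, P⁆ ⊔ ⁅Z, (⊤ : Subgroup G)⁆ := by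
  set D : Subgroup G := ⁅N, P⁆ ⊔ ⁅Z, (⊤ : Subgroup G)⁆ with hDdef
  haveI hDn : D.Normal := Subgroup.sup_normal _ _
  have hNPD : ⁅N, P⁆ ≤ D := le_sup_left
  have hZGD : ⁅Z, (⊤ : Subgroup G)⁆ ≤ D := le_sup_right
  have hDZ : D ≤ Z := sup_le hNPZ (Subgroup.commutator_le_left Z ⊤)
  have hNNZ : ⁅N, N⁆ ≤ Z := (Subgroup.commutator_mono le_rfl hNP).trans hNPZ
  have hNND : ⁅N, N⁆ ≤ D := (Subgroup.commutator_mono le_rfl hNP).trans hNPD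
  let mk := QuotientGroup.mk' D
  obtain ⟨J, hJ⟩ := exists_subgroup_commutator_classes N D hNND t
  have hmemN : ∀ a ∈ N, ∀ g : G, ⁅a, g⁆ ∈ N := fun a ha g => by
    rw [commutatorElement_def]
    have : a * g * a⁻¹ * g⁻¹ = a * (g * a⁻¹ * g⁻¹) := by group
    rw [this]; exact N.mul_mem ha (hN.conj_mem _ (N.inv_mem ha) g)
  -- (J2a) classes of `⁅a, t ^ c⁆` lie in `J`
  have hpow : ∀ c : ℕ, ∀ a ∈ N, mk ⁅a, t ^ c⁆ ∈ J := by
    intro c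
    induction c with
    | zero => intro a _; rw [pow_zero]; simp [J.one_mem]
    | succ c ih =>
      intro a ha
      rw [pow_succ, commutatorElement_mul_right', map_mul]
      exact J.mul_mem ((hJ _).mpr ⟨a, ha, rfl⟩) (ih _ (hN.conj_mem _ ha t))
  -- (J2) classes of conjugates `g ⁅a, t⁆ g⁻¹` lie in `J`
  have hconjJ : ∀ a ∈ N, ∀ g : G, mk (g * ⁅a, t⁆ * g⁻¹) ∈ J := by
    intro a ha g
    obtain ⟨c, y, hy, hgt⟩ := ht_conj g
    rw [conjugate_commutatorElement, hgt, commutatorElement_mul_right_eq_mul_conj]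
    have h2 : mk (t ^ c * ⁅g * a * g⁻¹, y⁆ * (t ^ c)⁻¹) = 1 := by
      rw [QuotientGroup.mk'_apply, QuotientGroup.eq_one_iff]
      exact hDn.conj_mem _ (hNPD (Subgroup.commutator_mem_commutator (hN.conj_mem _ ha g) hy)) _
    have h3 : mk (⁅g * a * g⁻¹, t ^ c⁆ * t ^ c * ⁅g * a * g⁻¹, y⁆ * (t ^ c)⁻¹) =
        mk ⁅g * a * g⁻¹, t ^ c⁆ * mk (t ^ c * ⁅g * a * g⁻¹, y⁆ * (t ^ c)⁻¹) := by
      rw [← map_mul]; congr 1; group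
    rw [h3, h2, mul_one]
    exact hpow c _ (hN.conj_mem _ ha g)
  -- conjugates of elements of `Z` have the same class
  have hZcen : ∀ z ∈ Z, ∀ g : G, mk (g * z * g⁻¹) = mk z := by
    intro z hz g
    rw [QuotientGroup.mk'_apply, QuotientGroup.mk'_apply, QuotientGroup.eq]
    have : (g * z * g⁻¹)⁻¹ * z = ⁅g, z⁻¹⁆ := by simp only [commutatorElement_def]; group
    rw [this]
    exact hZGD (by
      rw [Subgroup.commutator_comm]
      exact Subgroup.commutator_mem_commutator (Subgroup.mem_top g) (Z.inv_mem hz))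
  -- surjectivity of `a ↦ ⁅a, t⁆` onto `N/Z`
  have hsurj := exists_commutator_inv_mul_mem_of_fpf N Z hNNZ t ht_fpf
  refine le_of_fpf_of_commutator_repr P N Z D hNP hZN hNPD hZGD hDZ hNG t ht_fpf ?_
  intro n hn g
  obtain ⟨a, ha, hna⟩ := hsurj n hn
  -- `n = ⁅a,t⁆ z₀⁻¹` with `z₀ = n⁻¹ ⁅a,t⁆ ∈ Z`
  set z₀ : G := n⁻¹ * ⁅a, t⁆ with hz₀
  have hn_eq : n = ⁅a, t⁆ * z₀⁻¹ := by rw [hz₀]; group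
  have hz1 : mk (g * z₀⁻¹ * g⁻¹) = mk z₀⁻¹ := hZcen _ (Z.inv_mem hna) g
  have e1 : mk n = mk ⁅a, t⁆ * (mk z₀)⁻¹ := by rw [hn_eq, map_mul, map_inv]
  have e2 : mk (g * n * g⁻¹) = mk (g * ⁅a, t⁆ * g⁻¹) * (mk z₀)⁻¹ := by
    have : g * n * g⁻¹ = (g * ⁅a, t⁆ * g⁻¹) * (g * z₀⁻¹ * g⁻¹) := by rw [hn_eq]; group
    rw [this, map_mul, hz1, map_inv]
  have hcls : mk ⁅n, g⁆ ∈ J := by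
    have hng : ⁅n, g⁆ = n * (g * n * g⁻¹)⁻¹ := by simp only [commutatorElement_def]; group
    have key : mk ⁅n, g⁆ = mk ⁅a, t⁆ * (mk (g * ⁅a, t⁆ * g⁻¹))⁻¹ := by
      rw [hng, map_mul, map_inv, e1, e2]; group
    rw [key]
    exact J.mul_mem ((hJ _).mpr ⟨a, ha, rfl⟩) (J.inv_mem (hconjJ a ha g))
  obtain ⟨a', ha', h⟩ := (hJ _).mp hcls
  refine ⟨a', ha', ?_⟩
  rw [QuotientGroup.mk'_apply, QuotientGroup.mk'_apply, QuotientGroup.eq] at h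
  exact h

/-- **`t` trivial on `N/Z` forces `⁅N, t⁆ ⊆ ⁅N,P⁆ ⊔ ⁅Z,G⁆` (coprimality).** Let `P` be a normal
`p`-subgroup, `Z ≤ N ≤ P` normal with `⁅N, P⁆ ≤ Z`, `t ^ e ∈ P` with `e` coprime to `p`, and suppose
`⁅n, t⁆ ∈ Z` for all `n ∈ N`.  Then `⁅n, t⁆ ∈ D := ⁅N,P⁆ ⊔ ⁅Z,G⁆` for all `n ∈ N`: modulo `D`,
`t n t⁻¹ = c n` with `c` central, so `n = t^e n t^{-e} ≡ c^e n`, whence `c^e ∈ D` and `c ∈ D`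
(`c` has `p`-power order). [cite: NikolovSegal2007, §7] -/
theorem commutator_mem_sup_of_triv_t {p : ℕ} [Fact p.Prime] (P N Z : Subgroup G) [hP : P.Normal]
    [hN : N.Normal] [hZ : Z.Normal] (hPp : IsPGroup p P) (t : G) {e : ℕ} (hte : t ^ e ∈ P)
    (hpe : p.Coprime e) (hNP : N ≤ P) (hZN : Z ≤ N)
    (ht_triv : ∀ n ∈ N, ⁅n, t⁆ ∈ Z) :
    ∀ n ∈ N, ⁅n, t⁆ ∈ ⁅N, P⁆ ⊔ ⁅Z, (⊤ : Subgroup G)⁆ := by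
  set D : Subgroup G := ⁅N, P⁆ ⊔ ⁅Z, (⊤ : Subgroup G)⁆ with hDdef
  haveI hDn : D.Normal := Subgroup.sup_normal _ _
  have hNPD : ⁅N, P⁆ ≤ D := le_sup_left
  have hZGD : ⁅Z, (⊤ : Subgroup G)⁆ ≤ D := le_sup_right
  let mk := QuotientGroup.mk' D
  have hZcen : ∀ z ∈ Z, ∀ g : G, mk (g * z * g⁻¹) = mk z := by
    intro z hz g
    rw [QuotientGroup.mk'_apply, QuotientGroup.mk'_apply, QuotientGroup.eq]
    have : (g * z * g⁻¹)⁻¹ * z = ⁅g, z⁻¹⁆ := by simp only [commutatorElement_def]; group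
    rw [this]
    exact hZGD (by
      rw [Subgroup.commutator_comm]
      exact Subgroup.commutator_mem_commutator (Subgroup.mem_top g) (Z.inv_mem hz))
  intro n hn
  -- `c = ⁅t, n⁆ ∈ Z`, `t n t⁻¹ = c n`
  set c : G := ⁅t, n⁆ with hc
  have hcZ : c ∈ Z := by rw [hc, ← commutatorElement_inv]; exact Z.inv_mem (ht_triv n hn)
  have htn : t * n * t⁻¹ = c * n := by rw [hc, commutatorElement_def]; group
  -- `mk (t^k n t^{-k}) = (mk c)^k * mk n`
  have hiter : ∀ k : ℕ, mk (t ^ k * n * (t ^ k)⁻¹) = mk c ^ k * mk n := by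
    intro k
    induction k with
    | zero => simp
    | succ k ih =>
      have h1 : t ^ (k + 1) * n * (t ^ (k + 1))⁻¹ =
          (t * c ^ k * t⁻¹) * (t * (c ^ k)⁻¹ * ((t ^ k * n * (t ^ k)⁻¹)) * t⁻¹) := by
        rw [pow_succ']; group
      have h2 : mk (t * (c ^ k)⁻¹ * (t ^ k * n * (t ^ k)⁻¹) * t⁻¹) =
          mk t * (mk c ^ k)⁻¹ * (mk c ^ k * mk n) * (mk t)⁻¹ := by
        rw [← ih]; simp only [map_mul, map_inv, map_pow]
      rw [h1, map_mul, h2, hZcen _ (Z.pow_mem hcZ k) t]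
      have h3 : mk t * (mk c ^ k)⁻¹ * (mk c ^ k * mk n) * (mk t)⁻¹ = mk (t * n * t⁻¹) := by
        simp only [map_mul, map_inv]; group
      rw [h3, htn, map_mul, map_pow, pow_succ]
      group
  -- at `k = e`: `t ^ e ∈ P` acts trivially on `n` modulo `D`
  have htriv : mk (t ^ e * n * (t ^ e)⁻¹) = mk n := by
    rw [QuotientGroup.mk'_apply, QuotientGroup.mk'_apply, QuotientGroup.eq]
    have : (t ^ e * n * (t ^ e)⁻¹)⁻¹ * n = ⁅t ^ e, n⁻¹⁆ := by simp only [commutatorElement_def]; group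
    rw [this]
    exact hNPD (by
      rw [Subgroup.commutator_comm]
      exact Subgroup.commutator_mem_commutator hte (N.inv_mem hn))
  have hce : c ^ e ∈ D := by
    have h := hiter e
    rw [htriv] at h
    have : mk c ^ e = 1 := by
      have := congrArg (· * (mk n)⁻¹) h
      simpa using this.symm
    rw [← map_pow] at this
    rwa [QuotientGroup.mk'_apply, QuotientGroup.eq_one_iff] at this
  -- `c` has `p`-power order, coprime to `e`
  have hcP : c ∈ P := hNP (hZN hcZ)
  obtain ⟨k, hk⟩ := hPp ⟨c, hcP⟩
  have hck : c ^ p ^ k = 1 := by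
    have := congrArg Subtype.val hk
    simpa using this
  have hcop : e.Coprime (orderOf c) :=
    (Nat.Coprime.coprime_dvd_right (orderOf_dvd_of_pow_eq_one hck) (Nat.Coprime.pow_right k hpe.symm))
  obtain ⟨m, hm⟩ := exists_pow_eq_self_of_coprime hcop
  have hcD : c ∈ D := by rw [← hm]; exact D.pow_mem hce m
  -- conclude `⁅n, t⁆ = c⁻¹ ∈ D`
  rw [← commutatorElement_inv, ← hc]
  exact D.inv_mem hcD

/-- **Top layer of `Z`, case `t` trivial (so `s` fixed-point-free).** In the setting of the module
docstring, if `⁅N, t⁆ ⊆ D := ⁅N,P⁆ ⊔ ⁅Z,G⁆` (e.g. by `commutator_mem_sup_of_triv_t`), `s` acts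
fixed-point-freely on `N/Z`, and `G` is generated by `P ∪ {t, s}`, then `Z ≤ ⁅N, P⁆ ⊔ ⁅Z, G⁆`: the set of
`g` with `⁅N, g⁆ ⊆ {⁅a, s⁆} · D` is a subgroup (`⁅n, gh⁆ = ⁅n,h⁆⁅hnh⁻¹,g⁆`) containing the generators.
[cite: NikolovSegal2007, §7] -/
theorem le_commutator_sup_of_triv_t (P N Z : Subgroup G) [hP : P.Normal] [hN : N.Normal]
    [hZ : Z.Normal] (t s : G) (hNP : N ≤ P) (hZN : Z ≤ N) (hNPZ : ⁅N, P⁆ ≤ Z)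
    (hNG : ⁅N, (⊤ : Subgroup G)⁆ = N)
    (hGgen : Subgroup.closure ((P : Set G) ∪ {t, s}) = ⊤)
    (ht_D : ∀ n ∈ N, ⁅n, t⁆ ∈ ⁅N, P⁆ ⊔ ⁅Z, (⊤ : Subgroup G)⁆)
    (hs_fpf : ∀ n ∈ N, ⁅n, s⁆ ∈ Z → n ∈ Z) :
    Z ≤ ⁅N, P⁆ ⊔ ⁅Z, (⊤ : Subgroup G)⁆ := by
  set D : Subgroup G := ⁅N, P⁆ ⊔ ⁅Z, (⊤ : Subgroup G)⁆ with hDdef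
  haveI hDn : D.Normal := Subgroup.sup_normal _ _
  have hNPD : ⁅N, P⁆ ≤ D := le_sup_left
  have hZGD : ⁅Z, (⊤ : Subgroup G)⁆ ≤ D := le_sup_right
  have hDZ : D ≤ Z := sup_le hNPZ (Subgroup.commutator_le_left Z ⊤)
  have hNND : ⁅N, N⁆ ≤ D := (Subgroup.commutator_mono le_rfl hNP).trans hNPD
  let mk := QuotientGroup.mk' D
  obtain ⟨J, hJ⟩ := exists_subgroup_commutator_classes N D hNND s
  -- the subgroup of `g` with all classes `⁅n, g⁆ D` in `J`
  let S : Subgroup G :=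
    { carrier := {g | ∀ n ∈ N, mk ⁅n, g⁆ ∈ J}
      mul_mem' := fun {g h} hg hh n hn => by
        rw [commutatorElement_mul_right', map_mul]
        exact J.mul_mem (hh n hn) (hg _ (hN.conj_mem _ hn h))
      one_mem' := fun n _ => by simp [J.one_mem]
      inv_mem' := fun {g} hg n hn => by
        have h1 : ⁅n, g⁻¹⁆ = ⁅g⁻¹ * n * g⁻¹⁻¹, g⁆⁻¹ := by
          have := commutatorElement_mul_right' n g g⁻¹
          rw [mul_inv_cancel, commutatorElement_one_right] at this
          exact eq_inv_of_mul_eq_one_left this.symm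
        rw [h1, map_inv]
        exact J.inv_mem (hg _ (hN.conj_mem _ hn g⁻¹)) }
  have hS : (⊤ : Subgroup G) ≤ S := by
    rw [← hGgen, Subgroup.closure_le]
    rintro g (hg | hg | hg)
    · intro n hn
      have : mk ⁅n, g⁆ = 1 := by
        rw [QuotientGroup.mk'_apply, QuotientGroup.eq_one_iff]
        exact hNPD (Subgroup.commutator_mem_commutator hn hg)
      rw [this]; exact J.one_mem
    · subst hg
      intro n hn
      have : mk ⁅n, g⁆ = 1 := by
        rw [QuotientGroup.mk'_apply, QuotientGroup.eq_one_iff]; exact ht_D n hn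
      rw [this]; exact J.one_mem
    · have : g = s := hg
      subst this
      intro n hn
      exact (hJ _).mpr ⟨n, hn, rfl⟩
  refine le_of_fpf_of_commutator_repr P N Z D hNP hZN hNPD hZGD hDZ hNG s hs_fpf ?_
  intro n hn g
  obtain ⟨a, ha, h⟩ := (hJ _).mp (hS (Subgroup.mem_top g) n hn)
  refine ⟨a, ha, ?_⟩
  rw [QuotientGroup.mk'_apply, QuotientGroup.mk'_apply, QuotientGroup.eq] at h
  exact h

end Literature.GroupTheory
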